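import Summits.CriticalPhenomena.Ising3DConformalLimit.Theses.SubPtolemyInterlacing
import Literature.Probability.LatticeModels.GeneralisedFreeFamily
import Literature.Barriers.CriticalPhenomena.ScaleCovarianceNotMoebius

/-!
# Disproof of `InterlacingForcesU4` (stmt-CriticalPhenomena-15704) — findings

Crux (route SubPtolemyInterlacing, r5):
`Interlacing → SubPtolemyFloor → ∀ ρ Δ S, ρ > 0 on (0,1] → HasPointwiseScalingLimit (criticalCorr 3) ρ S
  → IsNondegenerateTwoPoint S → IsTranslationInvariant S → IsScaleCovariant Δ S → HasNontrivialU4 S`.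

## Verdict (cdisprove cycle 1, 2026-08-16): NO KILL — the crux is a THEOREM
(landed meanwhile: `Summit.CriticalPhenomena.Ising3DConformalLimit.Theorems.interlacingForcesU4_proof`).
* An unconditional `¬ InterlacingForcesU4` is `Interlacing ∧ SubPtolemyFloor ∧ ∃ bad limit`; both
  conjuncts are OPEN lattice conjectures (r2, r3 of the route), so no refutation is reachable by logic,
  and the inner implication is valid (re-derived independently below: §B is its exact arithmetic core).
* No vacuity: the hypotheses on (ρ, Δ, S) are satisfiable by the conjectured Ising limit; no junk:
  `IsNondegenerateTwoPoint` is the strong `∀ x ≠ y, 0 < S₂` form (gives κ = S₂(0,e₁) > 0 on the floor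
  axis), `latticeApprox δ (t e₁) = ⌊t/δ⌋ e₁`, `HasNontrivialU4` is a bare `∃`.

## What IS recorded here (checked, sorry-free) — load-bearing / tightness analysis
* §A `SubPtolemyAtXStar S`: the continuum face of `Interlacing` that the proof consumes (exactly the
  conclusion of `interlacingForcesU4_limit_subPtolemy`, at x⋆ = (0,2,3,6)·e₁).
* §B `gff_subPtolemyAtXStar_iff`: the generalised free field `gffFamily Δ` (Möbius covariant for every
  Δ, non-degenerate, U₄ ≡ 0 — `Literature/…/GeneralisedFreeFamily.lean`) satisfies the x⋆ inequality
  IFF `log₂(1+√2) ≤ 2Δ`.  Hence: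
* §C `ContinuumKernelXStar t` := "TI + SC(Δ) + ND + SubPtolemyAtXStar + 2Δ < t ⇒ U₄ ≢ 0" — the
  continuum kernel of the crux with the floor-derived exponent bound `t` as a parameter — HOLDS at
  `t = log₂(1+√2)` (that is the landed proof) and FAILS for every `t > log₂(1+√2)`
  (`not_continuumKernelXStar`), even with full Möbius covariance thrown in
  (`exists_moebius_gaussian_subPtolemyAtXStar`).  So the threshold `a < log₂(1+√2)` in
  `SubPtolemyFloor` (η(3) < 0.2716) is EXACTLY the limit of the x⋆ mechanism: it cannot be relaxed to
  the Simon–Lieb floor (a = 2), to Duminil-Copin–Panis (a = 3/2), or to any a ≥ 1.2716, by any proof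
  that uses `Interlacing` only through its limit at x⋆.
* Numerics (not formalised; python, this session): for the Gaussian family with S₂ = d^{-s} the axis
  sub-Ptolemy inequality at a general interlaced quadruple with pairing products X = ac, Y = b(a+b+c)
  reads f_s(p) := p^s + (1-p)^s + (p(1-p))^s ≤ 1, p = X/(X+Y).  max_p f_s = f_s(1/2) = 2·2^{-s}+4^{-s}
  for s ≤ s₀ = log₂(1+√2) = 1.27155…, and sup_p f_s = 1 (p → 0) with f_s < 1 on (0,1) for s > s₀
  (scan step 5·10⁻⁶; s = 1.28: max 0.999994 at the boundary, f(1/2) = 0.99317).  I.e. the balanced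
  point is the optimal configuration and NO other axis quadruple lowers the floor threshold: the whole
  collinear-SPC mechanism is exhausted at η < 0.2716.
* §D load-bearing audit of the remaining hypotheses (prose, from reading the landed proof):
  `hρ` (ρ > 0) is mathematically unnecessary (ρ⁸ ≥ 0; the dyadic ratio cancels ρ²) — used only via
  `tendsto_log_rho_sq_div`; `IsScaleCovariant` is used at (n,c) = (2,2) only and `IsTranslationInvariant`
  for two axis shifts only (both are automatic for genuine non-degenerate limits of a lattice-translation-
  invariant family); `HasPointwiseScalingLimit` only pointwise, n ∈ {2,4}, along dyadic meshes at x⋆ and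
  (0, e₁); `Interlacing` only at the balanced dyadic quadruples (2N, N, 3N), N = 2^{k+1}, eventually —
  so the EVENTUAL / dyadic-only restatement of r2 keeps r5.  `SubPtolemyFloor` is fully load-bearing
  and sharp (§C).
-/

noncomputable section

open Literature.Probability.LatticeModels
open Summit.CriticalPhenomena.Ising3DConformalLimit.Theses.SubPtolemyInterlacing

namespace Summit.CriticalPhenomena.Ising3DConformalLimit.Cruxes.InterlacingForcesU4.Disproof

/-! ## §A  The balanced configuration and the continuum sub-Ptolemy inequality at it -/

/-- The axis point `t·e₁ ∈ ℝ³`. -/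
def axPt (t : ℝ) : EuclideanSpace ℝ (Fin 3) := EuclideanSpace.single 0 t

/-- The Ptolemy-balanced configuration `x⋆ = (0, 2e₁, 3e₁, 6e₁)` (pairing products 6, 6 | 12). -/
def xStar : Fin 4 → EuclideanSpace ℝ (Fin 3) := ![axPt 0, axPt 2, axPt 3, axPt 6]

/-- The continuum sub-Ptolemy inequality at `x⋆`:
`S₄(x⋆) · S₂(x₀,x₂) S₂(x₁,x₃) ≤ S₂(x₀,x₁) S₂(x₂,x₃) · S₂(x₀,x₃) S₂(x₁,x₂)`
(crossing pairing on the left; the shape delivered by `Interlacing` in the limit, cf.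
`Theorems.interlacingForcesU4_limit_subPtolemy`). -/
def SubPtolemyAtXStar (S : CorrFamily 3) : Prop :=
  S 4 xStar * (S 2 ![xStar 0, xStar 2] * S 2 ![xStar 1, xStar 3]) ≤
    S 2 ![xStar 0, xStar 1] * S 2 ![xStar 2, xStar 3] * (S 2 ![xStar 0, xStar 3] * S 2 ![xStar 1, xStar 2])

/-- The Gaussian two-point function between axis points. -/
theorem gffTwo_axPt (Δ a b : ℝ) : gffTwo Δ (axPt a) (axPt b) = |a - b| ^ (-(2 * Δ)) := by
  rw [gffTwo, ← dist_eq_norm]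
  simp [axPt, Real.dist_eq]

theorem gff_two_pair (Δ : ℝ) (p q : EuclideanSpace ℝ (Fin 3)) :
    gffFamily Δ 2 ![p, q] = gffTwo Δ p q := rfl

theorem gff_four (Δ : ℝ) (x : Fin 4 → EuclideanSpace ℝ (Fin 3)) :
    gffFamily Δ 4 x = gffTwo Δ (x 0) (x 1) * gffTwo Δ (x 2) (x 3)
      + gffTwo Δ (x 0) (x 2) * gffTwo Δ (x 1) (x 3) + gffTwo Δ (x 0) (x 3) * gffTwo Δ (x 1) (x 2) := rfl

/-! ## §B  The GFF satisfies the x⋆ inequality iff `log₂(1+√2) ≤ 2Δ` -/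

/-- `2^{-log₂(1+√2)} = √2 - 1`. -/
theorem two_rpow_neg_logb : (2:ℝ) ^ (-(Real.logb 2 (1 + Real.sqrt 2))) = Real.sqrt 2 - 1 := by
  have hpos : 0 < 1 + Real.sqrt 2 := by positivity
  rw [Real.rpow_neg (by norm_num), Real.rpow_logb (by norm_num) (by norm_num) hpos]
  have hs : Real.sqrt 2 ^ 2 = 2 := Real.sq_sqrt (by norm_num)
  have hkey : (1 + Real.sqrt 2) * (Real.sqrt 2 - 1) = 1 := by nlinarith [hs]
  exact inv_eq_of_mul_eq_one_right hkey

/-- Quadratic threshold: for `u > 0`, `2u + u² ≤ 1 ↔ u ≤ √2 - 1`. -/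
theorem two_mul_add_sq_le_one_iff {u : ℝ} (hu : 0 < u) :
    2 * u + u * u ≤ 1 ↔ u ≤ Real.sqrt 2 - 1 := by
  have hs : Real.sqrt 2 ^ 2 = 2 := Real.sq_sqrt (by norm_num)
  have hs0 : 0 ≤ Real.sqrt 2 := Real.sqrt_nonneg 2
  constructor
  · intro h
    by_contra hc
    push Not at hc
    nlinarith [hc, hs, hs0, hu]
  · intro h
    have h1 : u + 1 ≤ Real.sqrt 2 := by linarith
    have h2 : (u + 1) * (u + 1) ≤ Real.sqrt 2 * Real.sqrt 2 :=
      mul_self_le_mul_self (by linarith) h1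
    nlinarith [h2, hs]

/-- **The generalised free field passes the x⋆ sub-Ptolemy test exactly from the threshold on.**
With `u = 2^{-2Δ}`, `k = 3^{-2Δ}` the six pair values at `x⋆` are `u, k, k, u², uk, 1`, the Wick sum
is `k(2u + u²)` and the inequality reads `k²u²(2u+u²) ≤ k²u²`, i.e. `2u + u² ≤ 1`, i.e.
`u ≤ √2 - 1 = 2^{-log₂(1+√2)}`. -/
theorem gff_subPtolemyAtXStar_iff (Δ : ℝ) :
    SubPtolemyAtXStar (gffFamily Δ) ↔ Real.logb 2 (1 + Real.sqrt 2) ≤ 2 * Δ := by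
  set u : ℝ := (2:ℝ) ^ (-(2 * Δ)) with hu
  set k : ℝ := (3:ℝ) ^ (-(2 * Δ)) with hk
  have hu0 : 0 < u := Real.rpow_pos_of_pos (by norm_num) _
  have hk0 : 0 < k := Real.rpow_pos_of_pos (by norm_num) _
  have hx0 : xStar 0 = axPt 0 := rfl
  have hx1 : xStar 1 = axPt 2 := rfl
  have hx2 : xStar 2 = axPt 3 := rfl
  have hx3 : xStar 3 = axPt 6 := rfl
  have h01 : gffTwo Δ (axPt 0) (axPt 2) = u := by
    rw [gffTwo_axPt, hu]; norm_num
  have h23 : gffTwo Δ (axPt 3) (axPt 6) = k := by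
    rw [gffTwo_axPt, hk]; norm_num
  have h02 : gffTwo Δ (axPt 0) (axPt 3) = k := by
    rw [gffTwo_axPt, hk]; norm_num
  have h13 : gffTwo Δ (axPt 2) (axPt 6) = u * u := by
    rw [gffTwo_axPt, hu, ← Real.mul_rpow (by norm_num) (by norm_num)]; norm_num
  have h03 : gffTwo Δ (axPt 0) (axPt 6) = u * k := by
    rw [gffTwo_axPt, hu, hk, ← Real.mul_rpow (by norm_num) (by norm_num)]; norm_num
  have h12 : gffTwo Δ (axPt 2) (axPt 3) = 1 := by
    rw [gffTwo_axPt]; norm_num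
  have hL : SubPtolemyAtXStar (gffFamily Δ) ↔ 2 * u + u * u ≤ 1 := by
    unfold SubPtolemyAtXStar
    simp only [gff_two_pair, gff_four, hx0, hx1, hx2, hx3, h01, h23, h02, h13, h03, h12]
    have hpos : 0 < k * k * (u * u) := by positivity
    constructor
    · intro h
      -- `k²u²(2u+u²) ≤ k²u²`
      by_contra hc
      push Not at hc
      nlinarith [mul_lt_mul_of_pos_left hc hpos, h]
    · intro h
      nlinarith [mul_le_mul_of_nonneg_left h hpos.le]
  rw [hL, two_mul_add_sq_le_one_iff hu0, ← two_rpow_neg_logb, hu,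
    Real.rpow_le_rpow_left_iff one_lt_two]
  constructor <;> intro h <;> linarith

/-! ## §C  The continuum kernel of the crux and the sharpness of the floor threshold -/

/-- The continuum kernel of `InterlacingForcesU4` with the exponent bound `t` as a parameter:
translation invariance + scale covariance (Δ) + non-degeneracy + the x⋆ sub-Ptolemy inequality +
`2Δ < t` force `U₄ ≢ 0`.  The landed proof of the crux is (floor ⇒ 2Δ ≤ a < log₂(1+√2)) followed by
this kernel at `t = log₂(1+√2)` (`interlacingForcesU4_u4_balanced_neg`). -/
def ContinuumKernelXStar (t : ℝ) : Prop :=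
  ∀ (Δ : ℝ) (S : CorrFamily 3), IsTranslationInvariant S → IsScaleCovariant Δ S →
    IsNondegenerateTwoPoint S → SubPtolemyAtXStar S → 2 * Δ < t → HasNontrivialU4 S

/-- `0 < log₂(1+√2)`. -/
theorem logb_two_one_add_sqrt_two_pos : 0 < Real.logb 2 (1 + Real.sqrt 2) :=
  Real.logb_pos one_lt_two (by linarith [Real.sqrt_pos.2 (show (0:ℝ) < 2 by norm_num)])

/-- **Witnesses above the threshold, with full Möbius covariance.** For every `Δ` with
`log₂(1+√2) ≤ 2Δ` there is a positive-dimension, non-degenerate, MÖBIUS covariant family obeying the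
x⋆ sub-Ptolemy inequality whose connected four-point function vanishes identically: `gffFamily Δ`. -/
theorem exists_moebius_gaussian_subPtolemyAtXStar {Δ : ℝ}
    (hΔ : Real.logb 2 (1 + Real.sqrt 2) ≤ 2 * Δ) :
    ∃ S : CorrFamily 3, 0 < Δ ∧ IsMoebiusCovariant Δ S ∧ IsNondegenerateTwoPoint S ∧
      SubPtolemyAtXStar S ∧ (∀ x, limitConnectedFour S x = 0) ∧ ¬ HasNontrivialU4 S :=
  ⟨gffFamily Δ, by linarith [logb_two_one_add_sqrt_two_pos], isMoebiusCovariant_gff Δ,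
    isNondegenerateTwoPoint_gff Δ, (gff_subPtolemyAtXStar_iff Δ).2 hΔ, limitConnectedFour_gff Δ,
    not_hasNontrivialU4_gff Δ⟩

/-- **SHARPNESS of the floor threshold (the `SubPtolemyFloor` exponent cannot be relaxed through x⋆).**
For every `t > log₂(1+√2)` the continuum kernel fails: witness `gffFamily (log₂(1+√2)/2)`, the
generalised free field AT the threshold (`u = √2 - 1`, equality in the x⋆ inequality). -/
theorem not_continuumKernelXStar {t : ℝ} (ht : Real.logb 2 (1 + Real.sqrt 2) < t) :
    ¬ ContinuumKernelXStar t := by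
  intro h
  set Δ : ℝ := Real.logb 2 (1 + Real.sqrt 2) / 2 with hΔ
  have h2Δ : 2 * Δ = Real.logb 2 (1 + Real.sqrt 2) := by rw [hΔ]; ring
  exact not_hasNontrivialU4_gff Δ
    (h Δ (gffFamily Δ) (isTranslationInvariant_gff Δ) (isScaleCovariant_gff Δ)
      (isNondegenerateTwoPoint_gff Δ) ((gff_subPtolemyAtXStar_iff Δ).2 h2Δ.ge) (by linarith))

/-- The same with the threshold phrased as in `SubPtolemyFloor` (`∃ a < t₀, … 2Δ ≤ a`): any proof
scheme "floor exponent `a < t₀` ⇒ `2Δ ≤ a` ⇒ kernel" needs `t₀ ≤ log₂(1+√2)`. -/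
theorem not_continuumKernelXStar_of_floorThreshold {t₀ : ℝ} (ht₀ : Real.logb 2 (1 + Real.sqrt 2) < t₀) :
    ¬ ∀ (a Δ : ℝ) (S : CorrFamily 3), a < t₀ → 2 * Δ ≤ a → IsTranslationInvariant S →
      IsScaleCovariant Δ S → IsNondegenerateTwoPoint S → SubPtolemyAtXStar S → HasNontrivialU4 S := by
  intro h
  obtain ⟨a, ha1, ha2⟩ := exists_between ht₀
  exact not_continuumKernelXStar ha1 fun Δ S htr hsc hnd hspc hlt =>
    h a Δ S ha2 hlt.le htr hsc hnd hspc

/-! ## §D  Lattice level: full axis interlacing + the Simon–Lieb floor `a = 2` do NOT force `U₄ ≢ 0`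

The crux is `LatticeKernel (log₂(1+√2))` specialised to `G = criticalCorr 3` (sanity `example`
below).  Here: `LatticeKernel t` is FALSE for every `t > 2` — witness the inverse-square Gaussian
family sampled on `ℤ³` (`latticeGff 1`), which satisfies the interlacing inequality at EVERY axis
quadruple (all gaps `a, b, c ≥ 1`, not only eventually/balanced), the floor with exponent exactly
`2` (Simon–Lieb's unconditional exponent for Ising), and converges under `ρ(δ) = δ⁻¹` locally
uniformly to the Möbius-covariant `gffFamily 1`, whose `U₄` vanishes identically.  So no proof of the
route can trade `SubPtolemyFloor` for the unconditional Simon–Lieb bound while using `Interlacing`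
and the limit package abstractly.  (For `t ∈ (log₂(1+√2), 2]` the lattice witnesses are the
`latticeGff (s/2)`, `s ∈ [log₂(1+√2), t)`, whose axis interlacing inequality is the numerical fact
`f_s ≤ 1` of the module docstring — not formalised for non-integer `s`; the continuum statement §C
covers that range.) -/

open Literature.Barriers.CriticalPhenomena.ScaleNotMoebius (tendstoLocallyUniformlyOn_comp_approx
  dist_round_le tendstoLocallyUniformlyOn_congr_eventually)
open Filter Topology

/-- The embedding `ℤ³ ↪ ℝ³`. -/
def ι (k : Site 3) : EuclideanSpace ℝ (Fin 3) := WithLp.toLp 2 fun j => (k j : ℝ)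

@[simp] theorem ι_apply (k : Site 3) (j : Fin 3) : ι k j = (k j : ℝ) := rfl

/-- Axis sites embed to axis points. -/
theorem ι_axis (k : ℕ) : ι ((k : ℤ) • (Pi.single 0 1 : Site 3)) = axPt k := by
  ext j
  fin_cases j <;> simp [axPt]

/-- `ι 0` as an axis point, with the cast shape of `gffTwo_one_axPt_nat` (`axPt ↑(0:ℕ)`, not the
real literal `0`, to keep unification syntactic). -/
theorem ι_zero : ι (0 : Site 3) = axPt ((0 : ℕ) : ℝ) := by
  rw [Nat.cast_zero]
  ext j
  fin_cases j <;> simp [axPt]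

/-- The generalised free field sampled on `ℤ³`. -/
def latticeGff (Δ : ℝ) : LatticeCorrFamily 3 := fun n k => gffFamily Δ n (fun i => ι (k i))

theorem gff_two (Δ : ℝ) (x : Fin 2 → EuclideanSpace ℝ (Fin 3)) :
    gffFamily Δ 2 x = gffTwo Δ (x 0) (x 1) := rfl

/-- `gffTwo Δ` is continuous in the pair off the diagonal. -/
theorem continuousOn_gffTwo (Δ : ℝ) {n : ℕ} (i j : Fin n) :
    ContinuousOn (fun x : Fin n → EuclideanSpace ℝ (Fin 3) => gffTwo Δ (x i) (x j)) {x | x i ≠ x j} := by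
  unfold gffTwo
  refine ContinuousOn.rpow_const ?_ fun x hx => Or.inl ?_
  · exact ((continuous_apply i).sub (continuous_apply j)).norm.continuousOn
  · exact norm_ne_zero_iff.2 (sub_ne_zero.2 hx)

/-- The GFF family is continuous on non-coincident configurations, in every arity. -/
theorem continuousOn_gffFamily (Δ : ℝ) (n : ℕ) :
    ContinuousOn (gffFamily Δ n) (NonCoincident 3 n) := by
  have hinj : ∀ {m : ℕ} (x : Fin m → EuclideanSpace ℝ (Fin 3)), x ∈ NonCoincident 3 m →
      Function.Injective x := fun x hx => (mem_nonCoincident x).1 hx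
  match n with
  | 0 => exact continuousOn_const
  | 1 => exact continuousOn_const
  | 2 =>
    refine ((continuousOn_gffTwo Δ (0 : Fin 2) 1).mono fun x hx h => ?_).congr fun x _ => rfl
    exact absurd (hinj x hx h) (by decide)
  | 3 => exact continuousOn_const
  | 4 =>
    have htp : ∀ i j : Fin 4, i ≠ j →
        ContinuousOn (fun x : Fin 4 → EuclideanSpace ℝ (Fin 3) => gffTwo Δ (x i) (x j))
          (NonCoincident 3 4) :=
      fun i j hij => (continuousOn_gffTwo Δ i j).mono fun x hx h => hij (hinj x hx h)
    refine ContinuousOn.congr ?_ (fun x _ => (rfl : gffFamily Δ 4 x = _))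
    exact (((htp 0 1 (by decide)).mul (htp 2 3 (by decide))).add
        ((htp 0 2 (by decide)).mul (htp 1 3 (by decide)))).add
        ((htp 0 3 (by decide)).mul (htp 1 2 (by decide)))
  | _ + 5 => exact continuousOn_const

/-- **The sampled GFF has the GFF as pointwise scaling limit** under `ρ(δ) = δ^{-Δ}`: by scale
covariance the rescaled correlator at mesh `δ` is `gffFamily Δ n` at the rounded configuration
`δ[x/δ]`, which converges locally uniformly on `NonCoincident` by continuity. -/
theorem latticeGff_hasPointwiseScalingLimit (Δ : ℝ) :
    HasPointwiseScalingLimit (latticeGff Δ) (fun δ => δ ^ (-Δ)) (gffFamily Δ) := by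
  intro n
  have key : ∀ δ, 0 < δ → ∀ x : Fin n → EuclideanSpace ℝ (Fin 3),
      rescaledCorrelator (latticeGff Δ) (fun δ => δ ^ (-Δ)) n δ x =
        gffFamily Δ n (fun i => δ • ι (latticeApprox δ (x i))) := by
    intro δ hδ x
    rw [rescaledCorrelator_apply, isScaleCovariant_gff Δ n δ hδ]
    simp only [latticeGff]
    congr 1
    rw [← Real.rpow_natCast, ← Real.rpow_mul hδ.le]
    congr 1
    ring
  have happrox := tendstoLocallyUniformlyOn_comp_approx (isOpen_nonCoincident 3 n)
    (continuousOn_gffFamily Δ n) (fun δ x i => δ • ι (latticeApprox δ (x i))) 3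
    (fun δ hδ x => dist_round_le hδ x)
  refine tendstoLocallyUniformlyOn_congr_eventually happrox ?_
  filter_upwards [self_mem_nhdsWithin] with δ hδ x _
  exact (key δ hδ x).symm

/-- The inverse-square kernel between axis points at natural distance `d`. -/
theorem gffTwo_one_axPt_nat {i j d : ℕ} (h : i + d = j) :
    gffTwo 1 (axPt i) (axPt j) = (((d : ℕ) : ℝ) ^ 2)⁻¹ := by
  rw [gffTwo_axPt]
  have hj : ((j : ℕ) : ℝ) = i + d := by rw [← h]; push_cast; ring
  rw [hj, show ((i : ℕ) : ℝ) - (i + d) = -d by ring, abs_neg, Nat.abs_cast,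
    show (-(2 * (1:ℝ))) = -((2 : ℕ) : ℝ) by norm_num, Real.rpow_neg (Nat.cast_nonneg _),
    Real.rpow_natCast]

/-- Axis two-point values of the sampled inverse-square GFF. -/
theorem latticeGff_one_two_axis {i j d : ℕ} (h : i + d = j) :
    latticeGff 1 2 ![((i : ℕ) : ℤ) • (Pi.single 0 1 : Site 3), ((j : ℕ) : ℤ) • (Pi.single 0 1 : Site 3)]
      = (((d : ℕ) : ℝ) ^ 2)⁻¹ := by
  simp only [latticeGff, gff_two, Matrix.cons_val_zero, Matrix.cons_val_one, Matrix.cons_val_fin_one,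
    ι_axis]
  exact gffTwo_one_axPt_nat h

/-- Axis four-point values of the sampled inverse-square GFF (Wick). -/
theorem latticeGff_one_four_axis {i j k l dij dkl dik djl dil djk : ℕ}
    (hij : i + dij = j) (hkl : k + dkl = l) (hik : i + dik = k) (hjl : j + djl = l)
    (hil : i + dil = l) (hjk : j + djk = k) :
    latticeGff 1 4 ![((i : ℕ) : ℤ) • (Pi.single 0 1 : Site 3), ((j : ℕ) : ℤ) • (Pi.single 0 1 : Site 3),
        ((k : ℕ) : ℤ) • (Pi.single 0 1 : Site 3), ((l : ℕ) : ℤ) • (Pi.single 0 1 : Site 3)]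
      = (((dij : ℕ) : ℝ) ^ 2)⁻¹ * (((dkl : ℕ) : ℝ) ^ 2)⁻¹ + (((dik : ℕ) : ℝ) ^ 2)⁻¹ * (((djl : ℕ) : ℝ) ^ 2)⁻¹
        + (((dil : ℕ) : ℝ) ^ 2)⁻¹ * (((djk : ℕ) : ℝ) ^ 2)⁻¹ := by
  simp only [latticeGff, gff_four, Matrix.cons_val_zero, Matrix.cons_val_one, Matrix.cons_val_two,
    Matrix.cons_val_three, Matrix.head_cons, Matrix.tail_cons, ι_axis]
  rw [gffTwo_one_axPt_nat hij, gffTwo_one_axPt_nat hkl, gffTwo_one_axPt_nat hik,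
    gffTwo_one_axPt_nat hjl, gffTwo_one_axPt_nat hil, gffTwo_one_axPt_nat hjk]

/-- **Core inequality (Ptolemy on a line, inverse-square weights).** With pairing products
`A = d₁₂d₃₄`, `B = d₁₄d₂₃` and crossing product `d₁₃d₂₄ = A + B`:
`(A⁻² + (A+B)⁻² + B⁻²)(A+B)⁻² ≤ A⁻² B⁻²`, since `(A+B)⁴ - (A²+B²)(A+B)² - A²B² = AB(2(A+B)² - AB) ≥ 0`. -/
theorem inv_sq_subPtolemy {A B : ℝ} (hA : 0 < A) (hB : 0 < B) :
    ((A ^ 2)⁻¹ + ((A + B) ^ 2)⁻¹ + (B ^ 2)⁻¹) * ((A + B) ^ 2)⁻¹ ≤ (A ^ 2)⁻¹ * (B ^ 2)⁻¹ := by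
  have hAB : 0 < A + B := by linarith
  rw [← sub_nonneg]
  have h : (A ^ 2)⁻¹ * (B ^ 2)⁻¹ - ((A ^ 2)⁻¹ + ((A + B) ^ 2)⁻¹ + (B ^ 2)⁻¹) * ((A + B) ^ 2)⁻¹
      = A * B * (2 * (A + B) ^ 2 - A * B) / (A ^ 2 * B ^ 2 * (A + B) ^ 4) := by
    field_simp
    ring
  rw [h]
  apply div_nonneg
  · have h1 : 0 ≤ 2 * (A + B) ^ 2 - A * B := by nlinarith [sq_nonneg (A - B), mul_pos hA hB]
    exact mul_nonneg (mul_nonneg hA.le hB.le) h1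
  · positivity

/-- The same in pairing variables: `S₄ = Wick`, crossing product `= A + B`. -/
theorem subPtolemy_of_wick {S4 g01 g23 g02 g13 g03 g12 A B : ℝ} (hA : 0 < A) (hB : 0 < B)
    (h01 : g01 * g23 = (A ^ 2)⁻¹) (hcross : g02 * g13 = ((A + B) ^ 2)⁻¹) (h03 : g03 * g12 = (B ^ 2)⁻¹)
    (hS4 : S4 = g01 * g23 + g02 * g13 + g03 * g12) :
    S4 * (g02 * g13) ≤ g01 * g23 * (g03 * g12) := by
  rw [hS4, h01, hcross, h03]
  exact inv_sq_subPtolemy hA hB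

/-- The crux's antecedent `Interlacing` with `criticalCorr 3` replaced by a lattice family `G`. -/
def InterlacingFor (G : LatticeCorrFamily 3) : Prop :=
  ∀ a b c : ℕ, 1 ≤ a → 1 ≤ b → 1 ≤ c →
    let p : ℕ → Site 3 := fun k => (k : ℤ) • (Pi.single 0 1 : Site 3)
    G 4 ![p 0, p a, p (a + b), p (a + b + c)] * (G 2 ![p 0, p (a + b)] * G 2 ![p a, p (a + b + c)]) ≤
      G 2 ![p 0, p a] * G 2 ![p (a + b), p (a + b + c)] *
        (G 2 ![p 0, p (a + b + c)] * G 2 ![p a, p (a + b)])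

/-- The crux's antecedent `SubPtolemyFloor` for a lattice family `G`, with the exponent bound `t`
as a parameter (`criticalTwoPoint 3 x = criticalCorr 3 2 ![0, x]`, `criticalCorr_two`). -/
def FloorFor (t : ℝ) (G : LatticeCorrFamily 3) : Prop :=
  ∃ a c : ℝ, a < t ∧ 0 < c ∧
    ∀ n : ℕ, 1 ≤ n → c * (n : ℝ) ^ (-a) ≤ G 2 ![0, (n : ℤ) • (Pi.single 0 1 : Site 3)]

/-- The crux with `criticalCorr 3` generalised to an arbitrary lattice family and the floor
threshold `log₂(1+√2)` generalised to `t`. -/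
def LatticeKernel (t : ℝ) : Prop :=
  ∀ G : LatticeCorrFamily 3, InterlacingFor G → FloorFor t G →
    ∀ (ρ : ℝ → ℝ) (Δ : ℝ) (S : CorrFamily 3), (∀ δ ∈ Set.Ioc (0:ℝ) 1, 0 < ρ δ) →
      HasPointwiseScalingLimit G ρ S → IsNondegenerateTwoPoint S → IsTranslationInvariant S →
      IsScaleCovariant Δ S → HasNontrivialU4 S

/-- Sanity: the crux IS the lattice kernel at `t = log₂(1+√2)`, `G = criticalCorr 3`. -/
example : LatticeKernel (Real.logb 2 (1 + Real.sqrt 2)) → InterlacingForcesU4 := by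
  intro h hI hF
  refine h (criticalCorr 3) hI ?_
  obtain ⟨a, c, ha, hc, hfloor⟩ := hF
  exact ⟨a, c, ha, hc, fun n hn => by rw [criticalCorr_two]; exact hfloor n hn⟩

/-- **The inverse-square lattice GFF obeys the interlacing inequality at EVERY axis quadruple.** -/
theorem interlacingFor_latticeGff_one : InterlacingFor (latticeGff 1) := by
  intro a b c ha hb hc
  dsimp only
  rw [latticeGff_one_four_axis (i := 0) (j := a) (k := a + b) (l := a + b + c) (dij := a) (dkl := c)
      (dik := a + b) (djl := b + c) (dil := a + b + c) (djk := b)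
      (by omega) (by omega) (by omega) (by omega) (by omega) (by omega),
    latticeGff_one_two_axis (d := a + b) (by omega), latticeGff_one_two_axis (d := b + c) (by omega),
    latticeGff_one_two_axis (d := a) (by omega), latticeGff_one_two_axis (d := c) (by omega),
    latticeGff_one_two_axis (d := a + b + c) (by omega), latticeGff_one_two_axis (d := b) (by omega)]
  have ha' : (0:ℝ) < a := by exact_mod_cast ha
  have hb' : (0:ℝ) < b := by exact_mod_cast hb
  have hc' : (0:ℝ) < c := by exact_mod_cast hc
  refine subPtolemy_of_wick (A := (a : ℝ) * c) (B := (b : ℝ) * (a + b + c)) (by positivity)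
    (by positivity) ?_ ?_ ?_ rfl
  · rw [← mul_inv, ← mul_pow]
  · push_cast; rw [← mul_inv, ← mul_pow]; congr 2; ring
  · push_cast; rw [← mul_inv, ← mul_pow]; congr 2; ring

/-- **… and the floor with the Simon–Lieb exponent `a = 2`** (so `FloorFor t` for every `t > 2`). -/
theorem floorFor_latticeGff_one {t : ℝ} (ht : 2 < t) : FloorFor t (latticeGff 1) := by
  refine ⟨2, 1, ht, one_pos, fun n hn => ?_⟩
  have h : latticeGff 1 2 ![0, (n : ℤ) • (Pi.single 0 1 : Site 3)] = (((n : ℕ) : ℝ) ^ 2)⁻¹ := by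
    simp only [latticeGff, gff_two, Matrix.cons_val_zero, Matrix.cons_val_one, Matrix.cons_val_fin_one,
      ι_axis, ι_zero]
    exact gffTwo_one_axPt_nat (i := 0) (by omega)
  rw [h, one_mul, show (-(2:ℝ)) = -((2:ℕ):ℝ) by norm_num, Real.rpow_neg (Nat.cast_nonneg _),
    Real.rpow_natCast]

/-- **SIMON–LIEB IS NOT ENOUGH (lattice kernel false above `t = 2`).** For every `t > 2` there is a
lattice family obeying the full axis interlacing inequality and a floor `c·n^{-a}` with `a < t`,
having a non-degenerate, translation-invariant, scale-covariant (indeed Möbius) pointwise scaling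
limit under a positive renormalisation, whose connected four-point function vanishes identically. -/
theorem not_latticeKernel_of_two_lt {t : ℝ} (ht : 2 < t) : ¬ LatticeKernel t := fun h =>
  not_hasNontrivialU4_gff 1
    (h (latticeGff 1) interlacingFor_latticeGff_one (floorFor_latticeGff_one ht) (fun δ => δ ^ (-(1:ℝ)))
      1 (gffFamily 1) (fun _ hδ => Real.rpow_pos_of_pos hδ.1 _) (latticeGff_hasPointwiseScalingLimit 1)
      (isNondegenerateTwoPoint_gff 1) (isTranslationInvariant_gff 1) (isScaleCovariant_gff 1))

/-- The witness package spelled out (for planners): everything the crux asks of `(G, ρ, Δ, S)` except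
`G = criticalCorr 3`, with floor exponent `2`, yet `U₄ ≡ 0`. -/
theorem exists_lattice_witness_floor_two :
    ∃ (G : LatticeCorrFamily 3) (ρ : ℝ → ℝ) (S : CorrFamily 3), InterlacingFor G ∧
      (∀ n : ℕ, 1 ≤ n → (n : ℝ) ^ (-(2:ℝ)) ≤ G 2 ![0, (n : ℤ) • (Pi.single 0 1 : Site 3)]) ∧
      (∀ δ ∈ Set.Ioc (0:ℝ) 1, 0 < ρ δ) ∧ HasPointwiseScalingLimit G ρ S ∧ IsNondegenerateTwoPoint S ∧
      IsMoebiusCovariant 1 S ∧ ∀ x, limitConnectedFour S x = 0 := by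
  obtain ⟨a, c, -, -, hfl⟩ := floorFor_latticeGff_one (t := 3) (by norm_num)
  refine ⟨latticeGff 1, fun δ => δ ^ (-(1:ℝ)), gffFamily 1, interlacingFor_latticeGff_one, ?_,
    fun _ hδ => Real.rpow_pos_of_pos hδ.1 _, latticeGff_hasPointwiseScalingLimit 1,
    isNondegenerateTwoPoint_gff 1, isMoebiusCovariant_gff 1, limitConnectedFour_gff 1⟩
  intro n hn
  have h : latticeGff 1 2 ![0, (n : ℤ) • (Pi.single 0 1 : Site 3)] = (((n : ℕ) : ℝ) ^ 2)⁻¹ := by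
    simp only [latticeGff, gff_two, Matrix.cons_val_zero, Matrix.cons_val_one, Matrix.cons_val_fin_one,
      ι_axis, ι_zero]
    exact gffTwo_one_axPt_nat (i := 0) (by omega)
  rw [h, show (-(2:ℝ)) = -((2:ℕ):ℝ) by norm_num, Real.rpow_neg (Nat.cast_nonneg _), Real.rpow_natCast]

end Summit.CriticalPhenomena.Ising3DConformalLimit.Cruxes.InterlacingForcesU4.Disproof

end
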